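import Mathlib
import Summits.Ventures.HodgeRepro.Tier4.Line4.Dichotomy

/-!
# Tier4/Line4/DichotomyRow — C-L4-DICHOTOMY = (S-DICH) under the ROW genericity predicate `IsGenuineRow`

Blind re-derivation cell `pub-hodge-repro`, Tier 4 «prove the step» (README §9–§10), seat t4-L1-p1 (prover, LINE L1,
gen 4; plan-4 g5's fix S15447 on Dichotomy p707809: the glue binds `Line1.IsGenuineRow W`, not the deprecated
`IsGenuine W`; the 400-line rule makes this a second module rather than an append).  Tree path
`lean/Summits/Ventures/HodgeRepro/Tier4/Line4/DichotomyRow.lean`.  Mathlib-level; no literature.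

WHAT IS PROVED (every declaration sorry-free, axioms `[propext, Classical.choice, Quot.sound]`).
* `isRegularRational_of_not_transporter_core (d) (hΩ : W.Ω * W.Ω = -(d • 1)) (hd : ¬ IsSquare (-d))
  (hPr : ∀ i, (W.P i).rank = 2) (hQr : ∀ i, (W.Q i).rank = 2) (γ) (h) : IsRegularRational W γ` — the (S-DICH) engine
  on the THREE clauses it uses (the `E′`-clause and the two rank clauses), the proof of Dichotomy p707809 verbatim on
  its helpers (`conjProj`, `eq_of_range_eq_of_range_compl_eq`, `map_torusT_eq_torusT'_of_conj`, L1-p3's ThreeLines).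
* **`isRegularRational_of_not_transporter_row (hg : IsGenuineRow W) (γ : rationalPoints W)
  (h : (torusT W).map (MulAut.conj ((γ : GA W))⁻¹).toMonoidHom ≠ torusT' W) : IsRegularRational W γ`** — the
  (S-DICH) theorem OF RECORD (the glue's `hg`), and `isRegularRational_of_not_transporter'` — the same under
  `IsGenuine W` (the landed form, re-derived from the core; p707809's theorem stays as landed).

Nothing here says anything about the status of the Hodge conjecture for CM abelian varieties, which is NOT proved
(HC_CM is NOT proved by anyone in this repository).
-/

set_option autoImplicit false
noncomputable section
namespace Summit.Ventures.HodgeRepro.Tier4.Line4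
open Summit.Ventures.HodgeRepro.Tier4 Summit.Ventures.HodgeRepro.Tier4.Common Summit.Ventures.HodgeRepro.Tier4.Line1
  NumberField Matrix

section DichotomyRow

variable {k : Type} [Field k] [NumberField k] (W : PlaneData k)

/-- **(S-DICH), the engine on its three clauses**: `Ω² = −d` with `−d` a non-square, `rank (P i) = rank (Q i) = 2`;
then a rational point that is not a transporter is regular (the proof of `isRegularRational_of_not_transporter`). -/
theorem isRegularRational_of_not_transporter_core {d : k} (hΩ : W.Ω * W.Ω = -(d • (1 : Matrix (Fin 4) (Fin 4) k)))
    (hd : ¬ IsSquare (-d)) (hPr : ∀ i, (W.P i).rank = 2) (hQr : ∀ i, (W.Q i).rank = 2) (γ : rationalPoints W)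
    (h : (torusT W).map (MulAut.conj ((γ : GA W))⁻¹).toMonoidHom ≠ torusT' W) :
    IsRegularRational W γ := by
  obtain ⟨u, hu, hu'⟩ := exists_rational_gl W γ
  have hcomm := rational_mat_comm_Ω W γ u hu
  intro t ht t' ht' hγ
  -- `t′ = γ⁻¹ t γ`
  have ht'eq : t' = (γ : GA W)⁻¹ * t * (γ : GA W) := by
    have h1 : (γ : GA W) * t' = t * γ := by
      calc (γ : GA W) * t' = t * (t⁻¹ * γ * t') := by group
        _ = t * γ := by rw [hγ]
    calc t' = (γ : GA W)⁻¹ * ((γ : GA W) * t') := by group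
      _ = (γ : GA W)⁻¹ * (t * γ) := by rw [h1]
      _ = (γ : GA W)⁻¹ * t * (γ : GA W) := by group
  -- `t` commutes with the transported projectors `R j`: `t = γ t′ γ⁻¹` and `t′` commutes with `Q j`
  have hteq : GA.mat W t = adMat k (u : Matrix (Fin 4) (Fin 4) k) * GA.mat W t' *
      adMat k ((u⁻¹ : GL (Fin 4) k) : Matrix (Fin 4) (Fin 4) k) := by
    have : t = (γ : GA W) * t' * (γ : GA W)⁻¹ := by rw [ht'eq]; group
    rw [this, GA.mat_mul, GA.mat_mul, hu, hu']
  have hinv1 : adMat k ((u⁻¹ : GL (Fin 4) k) : Matrix (Fin 4) (Fin 4) k) *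
      adMat k (u : Matrix (Fin 4) (Fin 4) k) = 1 := by
    rw [← adMat_mul, Units.inv_mul, adMat_one]
  have hRcomm : ∀ j : Fin 2, GA.mat W t * adMat k (conjProj W u j) = adMat k (conjProj W u j) * GA.mat W t := by
    intro j
    have hQ : GA.mat W t' * adMat k (W.Q j) = adMat k (W.Q j) * GA.mat W t' := by
      rcases j with ⟨j, hj⟩
      interval_cases j
      · exact ht'.1
      · exact ht'.2
    unfold conjProj
    rw [adMat_mul, adMat_mul, hteq]
    set U := adMat k (u : Matrix (Fin 4) (Fin 4) k)
    set V := adMat k ((u⁻¹ : GL (Fin 4) k) : Matrix (Fin 4) (Fin 4) k)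
    set X := GA.mat W t'
    set Y := adMat k (W.Q j)
    calc U * X * V * (U * Y * V) = U * X * (V * U) * Y * V := by simp only [mul_assoc]
      _ = U * (X * Y) * V := by rw [hinv1, mul_one]; simp only [mul_assoc]
      _ = U * (Y * X) * V := by rw [hQ]
      _ = U * Y * (V * U) * X * V := by rw [hinv1, mul_one]; simp only [mul_assoc]
      _ = U * Y * V * (U * X * V) := by simp only [mul_assoc]
  -- the facts about the transported projectors
  have hRΩ : ∀ j, conjProj W u j * W.Ω = W.Ω * conjProj W u j := conjProj_comm_Ω W u hcomm
  have hRr : ∀ j, (conjProj W u j).rank = 2 := fun j => by rw [conjProj_rank]; exact hQr j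
  -- a scalar `t` settles the claim
  have hscalar : ∀ j : Fin 2, (∃ z ∈ LinearMap.range (conjProj W u j).mulVecLin,
      W.P 0 *ᵥ z ≠ 0 ∧ W.P 1 *ᵥ z ≠ 0) → t ∈ centre W ∧ t' = t := by
    intro j hz
    obtain ⟨z, hzR, hx, hy⟩ := hz
    obtain ⟨c, e, hce⟩ := mat_eq_scalar_of_three_lines W hΩ hd (hPr 0) (hPr 1) (hRΩ j) (hRr j) hzR hx hy t
      ht.1 ht.2 (hRcomm j)
    have hcent : t ∈ Subgroup.center (GA W) := mem_center_of_mat_eq_scalar W t hce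
    have ht't : t' = t := by
      rw [ht'eq]
      have := (Subgroup.mem_center_iff.1 hcent) (γ : GA W)
      calc (γ : GA W)⁻¹ * t * (γ : GA W) = (γ : GA W)⁻¹ * (t * γ) := by group
        _ = (γ : GA W)⁻¹ * (γ * t) := by rw [← this]
        _ = t := by group
    refine ⟨⟨⟨ht, ?_⟩, hcent⟩, ht't⟩
    rw [← ht't]
    exact ht'
  -- the dichotomy on the two transported lines
  by_cases hz0 : ∃ z ∈ LinearMap.range (conjProj W u 0).mulVecLin, W.P 0 *ᵥ z ≠ 0 ∧ W.P 1 *ᵥ z ≠ 0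
  · exact hscalar 0 hz0
  by_cases hz1 : ∃ z ∈ LinearMap.range (conjProj W u 1).mulVecLin, W.P 0 *ᵥ z ≠ 0 ∧ W.P 1 *ᵥ z ≠ 0
  · exact hscalar 1 hz1
  -- both transported lines are `P`-lines
  have hline : ∀ j : Fin 2, LinearMap.range (conjProj W u j).mulVecLin = LinearMap.range (W.P 0).mulVecLin ∨
      LinearMap.range (conjProj W u j).mulVecLin = LinearMap.range (W.P 1).mulVecLin := by
    intro j
    by_contra hcon
    have hcon' := not_or.1 hcon
    have hz := exists_mem_range_components_ne_zero W hΩ hd (hPr 0) (hPr 1) (hRΩ j) (hRr j) hcon'.1 hcon'.2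
    rcases j with ⟨j, hj⟩
    interval_cases j
    · exact hz0 hz
    · exact hz1 hz
  exfalso
  apply h
  -- the two transported lines are distinct, so they are the two `P`-lines in some order
  have hne : LinearMap.range (conjProj W u 0).mulVecLin ≠ LinearMap.range (conjProj W u 1).mulVecLin :=
    range_ne_range_compl (conjProj_idem W u 1) (conjProj_sum W u) (ne_zero_of_rank_eq_two (hRr 1))
  have hP10 : W.P 1 + W.P 0 = 1 := by rw [add_comm]; exact W.P_sum
  have hR10 : conjProj W u 1 + conjProj W u 0 = 1 := by rw [add_comm]; exact conjProj_sum W u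
  have hR10' : conjProj W u 1 * conjProj W u 0 = 0 := by
    have hsum := conjProj_sum W u
    have : conjProj W u 0 = 1 - conjProj W u 1 := eq_sub_of_add_eq hsum
    rw [this, mul_sub, mul_one, conjProj_idem, sub_self]
  rcases hline 0 with h00 | h01 <;> rcases hline 1 with h10 | h11
  · exact absurd (h00.trans h10.symm) hne
  · -- `R 0 = P 0`, `R 1 = P 1`
    have e0 : conjProj W u 0 = W.P 0 :=
      eq_of_range_eq_of_range_compl_eq (conjProj_idem W u 0) (conjProj_mul_zero_one W u) W.P_sum h00 h11
    have e1 : conjProj W u 1 = W.P 1 :=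
      eq_of_range_eq_of_range_compl_eq (conjProj_idem W u 1) hR10' hP10 h11 h00
    exact map_torusT_eq_torusT'_of_conj W γ u hu hu' (i := 0) (i' := 1) (by decide)
      (Q_eq_of_conjProj_eq W u e0) (Q_eq_of_conjProj_eq W u e1)
  · -- `R 0 = P 1`, `R 1 = P 0`
    have e0 : conjProj W u 0 = W.P 1 :=
      eq_of_range_eq_of_range_compl_eq (conjProj_idem W u 0) (conjProj_mul_zero_one W u) hP10 h01 h10
    have e1 : conjProj W u 1 = W.P 0 :=
      eq_of_range_eq_of_range_compl_eq (conjProj_idem W u 1) hR10' W.P_sum h10 h01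
    exact map_torusT_eq_torusT'_of_conj W γ u hu hu' (i := 1) (i' := 0) (by decide)
      (Q_eq_of_conjProj_eq W u e0) (Q_eq_of_conjProj_eq W u e1)
  · exact absurd (h01.trans h11.symm) hne

/-- **(S-DICH) of record — under the row genericity predicate** `IsGenuineRow W` (the glue's `hg`). -/
theorem isRegularRational_of_not_transporter_row (hg : IsGenuineRow W) (γ : rationalPoints W)
    (h : (torusT W).map (MulAut.conj ((γ : GA W))⁻¹).toMonoidHom ≠ torusT' W) :
    IsRegularRational W γ := by
  obtain ⟨⟨d, hΩ, hd⟩, -, -, -, hPr, hQr⟩ := hg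
  exact isRegularRational_of_not_transporter_core W hΩ hd hPr hQr γ h

/-- (S-DICH) under `IsGenuine W`, re-derived from the core (p707809's `isRegularRational_of_not_transporter` is the
same statement, as landed). -/
theorem isRegularRational_of_not_transporter' (hg : IsGenuine W) (γ : rationalPoints W)
    (h : (torusT W).map (MulAut.conj ((γ : GA W))⁻¹).toMonoidHom ≠ torusT' W) :
    IsRegularRational W γ := by
  obtain ⟨⟨d, hΩ, hd⟩, -, -, -, hPr, hQr⟩ := hg
  exact isRegularRational_of_not_transporter_core W hΩ hd hPr hQr γ h

end DichotomyRow

end Summit.Ventures.HodgeRepro.Tier4.Line4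

end
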